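import Summits.BirchSwinnertonDyer.BirchSwinnertonDyer.Theorems.Rank1ResidualJetPairingCountingSplit
import HarnessLib

/-!
# T1 JET (cell `bsd-jet`), road K: Poitou–Tate counting SIGN BY SIGN, abstract form — involutions
# compatible with a perfect `ℤ/n`-pairing (`n` odd) split everything into `±`-eigenspaces, and the
# counting identity `[L + F : F] · [L' + G^⊥ : G^⊥] = [G : F]` holds on each sign separately

HONEST FRAMING (programme file `BSD-LIT2PART-PROGRAMME-v1.md` §HONESTY, verbatim): «no tranche here
proves BSD; ARM L moves the LITERAL column of an r ≤ 1 census into the kernel-proved-modulo-named-print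
column; ARM P changes what «named print» is worth.» THEOREMS ONLY (seat `bsd-jet-pv-1`, session g3;
`--supports stmt-BirchSwinnertonDyer-14418`, helper): no definition, no named fact, no `sorry`;
PURE ALGEBRA. Nothing is booked; 0 classes move.

## Why (stub S1 of the (J∥) kernel line, sheet `HOME/sheets/PV2-J6-KERNEL.md` §2: «`±` eigenspaces of
## `H¹(K, E[p^m])` under `Gal(K/ℚ)` … plus the `±`-compatibility of localisation and of the Tate pairing»)

Jetchev 2008, §5 (p. 822): Thm. 5.1 is stated on the `±`-eigenspaces for complex conjugation and
«the images … are exact orthogonal complements with respect to the local pairings `∑_v ⟨,⟩^±_v`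
obtained from the Tate pairings on the `±`-parts»; Lemma 5.2 (iii) `a^± + (a^*)^± = m`; the proof of
Thm. 6.3 (p. 823) counts on the `−ε(c)` side only. The cell's abstract Thm. 6.3
(`JET.Section6.tamagawaExponent_le_mInfty_of_minimalCoreVertex`, p471669) therefore needs the COUNTING
form of Poitou–Tate PER SIGN. This file supplies the pure-algebra half of that passage: for a perfect
pairing `bS : X × Y → ℤ/n` (`n` odd, `X`, `Y` finite and killed by `n`) and involutions `τ_X`, `τ_Y`
with `⟨τ_X x, τ_Y y⟩ = ⟨x, y⟩` — in the source, `τ` acting on `⊕_v H¹(K_v, E[p^m])` and on the dual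
side, the sum of the local Tate pairings being `τ`-invariant — one has `X = X⁺ ⊕ X⁻`, `Y = Y⁺ ⊕ Y⁻`
(`2` is invertible), `X⁺ ⊥ Y⁻` and `X⁻ ⊥ Y⁺` (`⟨x, y⟩ = −⟨x, y⟩ ⟹ 2⟨x, y⟩ = 0 ⟹ ⟨x, y⟩ = 0`),
every `τ`-stable subgroup splits, and hence (file `…PairingCountingSplit`) the counting identity of
`GlobalDuality.relIndex_mul_relIndex_eq_of_iInf_ker_sup` holds on the `+` parts and on the `−` parts
separately. What remains of S1 is the Galois side: `τ` on `galoisCohomology` at level `p^m` (the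
tree's `conjAct` is at level `p`), its compatibility with `localization` (permuting `v ↔ v̄`) and the
`τ`-invariance of the sum of the local Tate pairings.

## What is proved (elementary)

* §4 `mem_ker_sub_id_iff` ∕ `mem_ker_add_id_iff` (the eigen-subgroups are the terms
  `ker (τ - id)`, `ker (τ + id)` — no definition); for `n` odd and `n · X = 0`:
  `X⁺ ⊔ X⁻ = ⊤` (`ker_sub_id_sup_ker_add_id_eq_top`), `X⁺ ⊓ X⁻ = ⊥`
  (`ker_sub_id_inf_ker_add_id_eq_bot`), `τ`-stable subgroups split (`le_inf_sup_inf_of_stable`);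
  in `ℤ/n`, `z + z = 0 ⟹ z = 0` (`zmod_eq_zero_of_add_self_eq_zero`); compatibility of the pairing
  with the involutions gives `X⁺ ⊥ Y⁻`, `X⁻ ⊥ Y⁺` (`pairing_eq_zero_of_mem_ker_…`).
* §5 `relIndex_mul_relIndex_eq_of_iInf_ker_sup_plus` ∕ `…_minus` — **the counting identity on the
  `+1`- and on the `−1`-eigenspaces**: for `τ`-stable `F ≤ G`, `L ≤ X`, `L' ≤ Y` with
  `(L + F)^⊥ = L' + G^⊥`: `F.relIndex (L ⊓ X^±) · G^⊥.relIndex (L' ⊓ Y^±) = F.relIndex (G ⊓ X^±)`.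

References (locators only; no cited FACT is declared): [cite: Jetchev2008, §5 Thm. 5.1, Lemma 5.2 (iii)
(p. 822), proof of Thm. 6.3 (p. 823)] [cite: MilneADT2006, Ch. I §0 (0.19)] [cite: GrossLMS1991,
Prop. 5.4 (ii) (eigenspaces of complex conjugation)].
Design: no definitions; `Type*`-polymorphic. Axioms: `propext`, `Classical.choice`, `Quot.sound`.
-/

set_option autoImplicit false

noncomputable section

open scoped Classical
open Function
open Literature.NumberTheory.GaloisRepresentations

namespace Summit.BirchSwinnertonDyer.Rank1Residual.JET.GlobalDuality

/-! ### §4 Involutions: `±`-eigen-subgroups split everything when `n` is odd -/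

section Involution

variable {X : Type*} [AddCommGroup X] (τ : X →+ X)

/-- Membership in the `+1`-eigen-subgroup `ker (τ - id)` of an endomorphism `τ`. -/
theorem mem_ker_sub_id_iff (x : X) : x ∈ (τ - AddMonoidHom.id X).ker ↔ τ x = x := by
  rw [AddMonoidHom.mem_ker, AddMonoidHom.sub_apply, AddMonoidHom.id_apply, sub_eq_zero]

/-- Membership in the `−1`-eigen-subgroup `ker (τ + id)` of an endomorphism `τ`. -/
theorem mem_ker_add_id_iff (x : X) : x ∈ (τ + AddMonoidHom.id X).ker ↔ τ x = -x := by
  rw [AddMonoidHom.mem_ker, AddMonoidHom.add_apply, AddMonoidHom.id_apply, add_eq_zero_iff_eq_neg]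

/-- An odd `n` has a «half of `n + 1`». -/
theorem exists_two_mul_eq_succ_of_odd {n : ℕ} (hn : Odd n) : ∃ m : ℕ, 2 * m = n + 1 := by
  obtain ⟨k, rfl⟩ := hn
  exact ⟨k + 1, by ring⟩

/-- In a group killed by `n` with `2 m = n + 1`, `x = m • (2 • x)`: `2` acts invertibly. -/
theorem eq_nsmul_two_nsmul {n m : ℕ} (hm : 2 * m = n + 1) (hX : ∀ x : X, n • x = 0) (x : X) :
    x = m • (2 • x) := by
  rw [← mul_nsmul', mul_comm, hm, add_nsmul, one_nsmul, hX, zero_add]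

variable {n : ℕ} (hn : Odd n) (hX : ∀ x : X, n • x = 0) (hτ : ∀ x, τ (τ x) = x)
include hn hX hτ

/-- For an involution `τ` on a group killed by an odd `n`: `X = X⁺ + X⁻`
(`x = m(x + τx) + m(x − τx)` with `2m = n + 1`). -/
theorem ker_sub_id_sup_ker_add_id_eq_top :
    (τ - AddMonoidHom.id X).ker ⊔ (τ + AddMonoidHom.id X).ker = ⊤ := by
  obtain ⟨m, hm⟩ := exists_two_mul_eq_succ_of_odd hn
  rw [eq_top_iff]
  intro x _
  have hx : x = m • (x + τ x) + m • (x - τ x) := by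
    rw [← nsmul_add, show x + τ x + (x - τ x) = 2 • x by rw [two_nsmul]; abel]
    exact eq_nsmul_two_nsmul hm hX x
  rw [hx]
  refine AddSubgroup.add_mem_sup (AddSubgroup.nsmul_mem _ ?_ m) (AddSubgroup.nsmul_mem _ ?_ m)
  · rw [mem_ker_sub_id_iff, map_add, hτ, add_comm]
  · rw [mem_ker_add_id_iff, map_sub, hτ, neg_sub]

omit hτ in
/-- For an endomorphism `τ` of a group killed by an odd `n`: `X⁺ ∩ X⁻ = 0` (`2` is invertible). -/
theorem ker_sub_id_inf_ker_add_id_eq_bot :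
    (τ - AddMonoidHom.id X).ker ⊓ (τ + AddMonoidHom.id X).ker = ⊥ := by
  obtain ⟨m, hm⟩ := exists_two_mul_eq_succ_of_odd hn
  rw [eq_bot_iff]
  intro x hx
  obtain ⟨hp, hm'⟩ := AddSubgroup.mem_inf.mp hx
  rw [mem_ker_sub_id_iff] at hp
  rw [mem_ker_add_id_iff] at hm'
  rw [AddSubgroup.mem_bot, eq_nsmul_two_nsmul hm hX x, two_nsmul]
  nth_rw 2 [← hp]
  rw [hm', add_neg_cancel, nsmul_zero]

/-- A `τ`-stable subgroup is split by `X = X⁺ ⊕ X⁻` (odd `n`): `S ≤ (S ∩ X⁺) + (S ∩ X⁻)`. -/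
theorem le_inf_sup_inf_of_stable {S : AddSubgroup X} (hS : ∀ s ∈ S, τ s ∈ S) :
    S ≤ S ⊓ (τ - AddMonoidHom.id X).ker ⊔ S ⊓ (τ + AddMonoidHom.id X).ker := by
  obtain ⟨m, hm⟩ := exists_two_mul_eq_succ_of_odd hn
  intro s hs
  have hx : s = m • (s + τ s) + m • (s - τ s) := by
    rw [← nsmul_add, show s + τ s + (s - τ s) = 2 • s by rw [two_nsmul]; abel]
    exact eq_nsmul_two_nsmul hm hX s
  rw [hx]
  refine AddSubgroup.add_mem_sup
    (AddSubgroup.nsmul_mem _ (AddSubgroup.mem_inf.mpr ⟨add_mem hs (hS s hs), ?_⟩) m)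
    (AddSubgroup.nsmul_mem _ (AddSubgroup.mem_inf.mpr ⟨sub_mem hs (hS s hs), ?_⟩) m)
  · rw [mem_ker_sub_id_iff, map_add, hτ, add_comm]
  · rw [mem_ker_add_id_iff, map_sub, hτ, neg_sub]

end Involution

section InvolutionPairing

/-- In `ℤ/n` with `n` odd, `z + z = 0` forces `z = 0`. -/
theorem zmod_eq_zero_of_add_self_eq_zero {n : ℕ} (hn : Odd n) (z : ZMod n) (hz : z + z = 0) :
    z = 0 := by
  obtain ⟨m, hm⟩ := exists_two_mul_eq_succ_of_odd hn
  have hzn : ∀ w : ZMod n, n • w = 0 := fun w => by rw [nsmul_eq_mul, ZMod.natCast_self, zero_mul]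
  rw [eq_nsmul_two_nsmul hm hzn z, two_nsmul, hz, nsmul_zero]

variable {X Y : Type*} [AddCommGroup X] [AddCommGroup Y] {n : ℕ} (hn : Odd n)
  (bS : X →+ Y →+ ZMod n) (τX : X →+ X) (τY : Y →+ Y)
  (hcompat : ∀ x y, bS (τX x) (τY y) = bS x y)
include hn hcompat

/-- Compatibility of the pairing with the involutions makes `X⁺ ⊥ Y⁻` (odd `n`):
`⟨x, y⟩ = ⟨τx, τy⟩ = −⟨x, y⟩`. -/
theorem pairing_eq_zero_of_mem_ker_sub_of_mem_ker_add (x : X)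
    (hx : x ∈ (τX - AddMonoidHom.id X).ker) (y : Y) (hy : y ∈ (τY + AddMonoidHom.id Y).ker) :
    bS x y = 0 := by
  rw [mem_ker_sub_id_iff] at hx
  rw [mem_ker_add_id_iff] at hy
  apply zmod_eq_zero_of_add_self_eq_zero hn
  nth_rw 2 [← hcompat x y]
  rw [hx, hy, map_neg, add_neg_cancel]

/-- Compatibility of the pairing with the involutions makes `X⁻ ⊥ Y⁺` (odd `n`). -/
theorem pairing_eq_zero_of_mem_ker_add_of_mem_ker_sub (x : X)
    (hx : x ∈ (τX + AddMonoidHom.id X).ker) (y : Y) (hy : y ∈ (τY - AddMonoidHom.id Y).ker) :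
    bS x y = 0 := by
  rw [mem_ker_add_id_iff] at hx
  rw [mem_ker_sub_id_iff] at hy
  apply zmod_eq_zero_of_add_self_eq_zero hn
  nth_rw 2 [← hcompat x y]
  rw [hx, hy, map_neg, AddMonoidHom.neg_apply, add_neg_cancel]

end InvolutionPairing

/-! ### §5 The counting identity on `±`-eigenspaces -/

section SignedCounting

variable {X Y : Type*} [AddCommGroup X] [AddCommGroup Y] [Finite X] [Finite Y] {n : ℕ} [NeZero n]
  (hn : Odd n) (bS : X →+ Y →+ ZMod n) (hX : ∀ x : X, n • x = 0) (hY : ∀ y : Y, n • y = 0)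
  (hl : Injective bS) (hr : Injective bS.flip) (τX : X →+ X) (τY : Y →+ Y)
  (hτX : ∀ x, τX (τX x) = x) (hτY : ∀ y, τY (τY y) = y)
  (hcompat : ∀ x y, bS (τX x) (τY y) = bS x y)
include hn hX hY hl hr hτX hτY hcompat

/-- **Poitou–Tate counting SIGN BY SIGN, abstract form (Jetchev 2008 Thm. 5.1 on the
`±`-eigenspaces; Lemma 5.2 (iii) `a^± + (a^*)^± = m`).** Perfect `bS : X × Y → ℤ/n`, `n` odd, on
finite groups killed by `n`; involutions `τ_X`, `τ_Y` with `⟨τ_X x, τ_Y y⟩ = ⟨x, y⟩` (in the source: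
complex conjugation `τ ∈ Gal(K/ℚ)` acting on `⊕_v H¹(K_v, E[p^m])` and on the dual side, the sum of
the local Tate pairings being `τ`-invariant); `τ`-stable subgroups `F ≤ G` of `X`, `L ≤ X`, `L' ≤ Y`
with `(L + F)^⊥ = L' + G^⊥`. Then for the `+1`-eigenspaces `X⁺ = ker(τ_X − 1)`, `Y⁺ = ker(τ_Y − 1)`:
`F.relIndex (L ∩ X⁺) · G^⊥.relIndex (L' ∩ Y⁺) = F.relIndex (G ∩ X⁺)`, i.e.
`[L⁺ + F⁺ : F⁺] · [L'⁺ + (G^⊥)⁺ : (G^⊥)⁺] = [G⁺ : F⁺]`. PROOF: `X = X⁺ ⊕ X⁻`, `Y = Y⁺ ⊕ Y⁻` (`2`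
is invertible), `X⁺ ⊥ Y⁻`, `X⁻ ⊥ Y⁺` (`⟨x,y⟩ = −⟨x,y⟩`), `τ`-stable subgroups split; apply
`relIndex_mul_relIndex_eq_of_iInf_ker_sup_of_split`. [cite: Jetchev2008, Thm. 5.1 (p. 822), Lemma 5.2 (iii)]
[cite: MilneADT2006, Ch. I §0 (0.19)] -/
theorem relIndex_mul_relIndex_eq_of_iInf_ker_sup_plus (F G L : AddSubgroup X) (L' : AddSubgroup Y)
    (hFG : F ≤ G) (sF : ∀ s ∈ F, τX s ∈ F) (sG : ∀ s ∈ G, τX s ∈ G) (sL : ∀ s ∈ L, τX s ∈ L)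
    (sL' : ∀ s ∈ L', τY s ∈ L')
    (hann : (⨅ s ∈ L ⊔ F, (bS s).ker : AddSubgroup Y) = L' ⊔ ⨅ s ∈ G, (bS s).ker) :
    F.relIndex (L ⊓ (τX - AddMonoidHom.id X).ker) *
        (⨅ s ∈ G, (bS s).ker : AddSubgroup Y).relIndex (L' ⊓ (τY - AddMonoidHom.id Y).ker) =
      F.relIndex (G ⊓ (τX - AddMonoidHom.id X).ker) :=
  relIndex_mul_relIndex_eq_of_iInf_ker_sup_of_split bS hX hY hl hr
    (τX - AddMonoidHom.id X).ker (τX + AddMonoidHom.id X).ker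
    (τY - AddMonoidHom.id Y).ker (τY + AddMonoidHom.id Y).ker
    (ker_sub_id_sup_ker_add_id_eq_top τX hn hX hτX) (ker_sub_id_inf_ker_add_id_eq_bot τX hn hX)
    (ker_sub_id_sup_ker_add_id_eq_top τY hn hY hτY) (ker_sub_id_inf_ker_add_id_eq_bot τY hn hY)
    (fun x hx y hy => pairing_eq_zero_of_mem_ker_sub_of_mem_ker_add hn bS τX τY hcompat x hx y hy)
    (fun x hx y hy => pairing_eq_zero_of_mem_ker_add_of_mem_ker_sub hn bS τX τY hcompat x hx y hy)
    F G L L' hFG (le_inf_sup_inf_of_stable τX hn hX hτX sF) (le_inf_sup_inf_of_stable τX hn hX hτX sG)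
    (le_inf_sup_inf_of_stable τX hn hX hτX sL) (le_inf_sup_inf_of_stable τY hn hY hτY sL') hann

/-- **The same on the `−1`-eigenspaces** `X⁻ = ker(τ_X + 1)`, `Y⁻ = ker(τ_Y + 1)`:
`F.relIndex (L ∩ X⁻) · G^⊥.relIndex (L' ∩ Y⁻) = F.relIndex (G ∩ X⁻)` (Jetchev's `−ε(c)` side, the
one carrying the inequality of Thm. 6.3). [cite: Jetchev2008, Thm. 5.1 (p. 822), Lemma 5.2 (iii), proof of Thm. 6.3 (p. 823)] -/
theorem relIndex_mul_relIndex_eq_of_iInf_ker_sup_minus (F G L : AddSubgroup X) (L' : AddSubgroup Y)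
    (hFG : F ≤ G) (sF : ∀ s ∈ F, τX s ∈ F) (sG : ∀ s ∈ G, τX s ∈ G) (sL : ∀ s ∈ L, τX s ∈ L)
    (sL' : ∀ s ∈ L', τY s ∈ L')
    (hann : (⨅ s ∈ L ⊔ F, (bS s).ker : AddSubgroup Y) = L' ⊔ ⨅ s ∈ G, (bS s).ker) :
    F.relIndex (L ⊓ (τX + AddMonoidHom.id X).ker) *
        (⨅ s ∈ G, (bS s).ker : AddSubgroup Y).relIndex (L' ⊓ (τY + AddMonoidHom.id Y).ker) =
      F.relIndex (G ⊓ (τX + AddMonoidHom.id X).ker) := by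
  have hXsup := ker_sub_id_sup_ker_add_id_eq_top τX hn hX hτX
  have hXinf := ker_sub_id_inf_ker_add_id_eq_bot τX hn hX
  have hYsup := ker_sub_id_sup_ker_add_id_eq_top τY hn hY hτY
  have hYinf := ker_sub_id_inf_ker_add_id_eq_bot τY hn hY
  rw [sup_comm] at hXsup hYsup
  rw [inf_comm] at hXinf hYinf
  have swap : ∀ {S : AddSubgroup X}, (∀ s ∈ S, τX s ∈ S) →
      S ≤ S ⊓ (τX + AddMonoidHom.id X).ker ⊔ S ⊓ (τX - AddMonoidHom.id X).ker :=
    fun hS => sup_comm (α := AddSubgroup X) _ _ ▸ le_inf_sup_inf_of_stable τX hn hX hτX hS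
  have swap' : L' ≤ L' ⊓ (τY + AddMonoidHom.id Y).ker ⊔ L' ⊓ (τY - AddMonoidHom.id Y).ker :=
    sup_comm (α := AddSubgroup Y) _ _ ▸ le_inf_sup_inf_of_stable τY hn hY hτY sL'
  exact relIndex_mul_relIndex_eq_of_iInf_ker_sup_of_split bS hX hY hl hr
    (τX + AddMonoidHom.id X).ker (τX - AddMonoidHom.id X).ker
    (τY + AddMonoidHom.id Y).ker (τY - AddMonoidHom.id Y).ker hXsup hXinf hYsup hYinf
    (fun x hx y hy => pairing_eq_zero_of_mem_ker_add_of_mem_ker_sub hn bS τX τY hcompat x hx y hy)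
    (fun x hx y hy => pairing_eq_zero_of_mem_ker_sub_of_mem_ker_add hn bS τX τY hcompat x hx y hy)
    F G L L' hFG (swap sF) (swap sG) (swap sL) swap' hann

end SignedCounting


end Summit.BirchSwinnertonDyer.Rank1Residual.JET.GlobalDuality

end
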